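import Summits.QuantumFields.BalabanUV.Beta.FP.CubicGermPairing

/-!
# `BalabanUV.Beta.FP.QuadGermUniqueness` — road «FP» for binder row D1, sub-row H2-G-QUAD-INV of row H2-G (owner b2b-balaban-beta-d1-p3):
# A HYPEROCTAHEDRALLY INVARIANT QUADRATIC GERM IS `quadGerm cQ α γ` — the quadratic twin of `MarginalUniqueness.cubic_unique` — AND THE SECOND-MOMENT
# GERM `quadMomentOf M` OF A LATTICE-COVARIANT HESSIAN COLUMN IS SUCH A GERM, WITH `cQ α γ` READ OFF THREE MOMENTS

HONEST DEPENDENCY (page 1, mandatory): continuum YM on T⁴ ⇐ BetaPertH ∧ nine spine estimates (0/9 proved); BetaPertH ⇐ (D1) ∧ (D4) ∧ CAP+tail;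
G-an2-4 gates asym, D1 and NE2/3/4.  HONEST FRAMING (cell contract, verbatim): «discharging `BetaPertH` makes Bałaban's UV stability UNCONDITIONAL —
a real constructive-QFT result; it is NOT the continuum limit and NOT the Clay problem.»  THIS MODULE DISCHARGES NOTHING of the wall: §1 is finite-dimensional
invariant theory over `Fin 4` (the tree's `FP/MarginalUniqueness` transports `eq_zero_of_flip` ∕ `val_aabb` ∕ `val_abab` ∕ `val_abba` ∕ `val_aaaa` BY NAME, applied to a
momentum-slot-constant table), §2 is `ℓ¹` bookkeeping on `ℤ⁴` (`FP/StencilMoments`, `FP/CubicGermPairing.quadMomentOf`); [folklore]; 0 def, no cite, no `def … : Prop`,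
0 sorry.  It supplies the hypothesis `hQ : c · quadMomentOf M = quadGerm cQ α γ` of `CubicGermWard.cubicGermOf_eq_of_law_anti13` from LATTICE SYMMETRY of the Hessian block
alone (Ward then forces `α = γ = 0`); it verifies that symmetry for NO effective or perfect Hessian.  NOT H2-G proper, NOT hasym, NOT D1, NOT BetaPertH, NOT continuum, NOT Clay.

ABSOLUTE RULE (cell charter, verbatim): «No internally-minted statement may enter as a cited fact. Every hypothesis is either kernel-proved in this package or a
verbatim quotation of a PUBLISHED theorem with page reference. The manuscript(s) under audit are NOT citable for their own disputed steps — they are the thing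
under adjudication; programme-internal (2001/route/tribunal) claims are never citable.»

WHAT IS PROVED.
* §1 For a table `T : Idx → Idx → Idx → Idx → ℝ` (coefficient of `k_a k_b` in `Q(k)_{μν}`) invariant under axis PERMUTATIONS (`T (σμ)(σν)(σa)(σb) = T μ ν a b`) and
  REFLECTIONS (`rs α μ · rs α ν · rs α a · rs α b · T μ ν a b = T μ ν a b`): **`quadTable_unique`** — `T μ ν a b = T₀₀₁₁·δ_{μν}δ_{ab} + T₀₁₀₁·δ_{μa}δ_{νb} +
  T₀₁₁₀·δ_{μb}δ_{νa} + (T₀₀₀₀ − T₀₀₁₁ − T₀₁₀₁ − T₀₁₁₀)·δ_{μν}δ_{μa}δ_{μb}` (four `B₄`-invariants of rank four); **`quadForm_eq_quadGerm`** —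
  `Σ_{a,b} T μ ν a b k_a k_b = quadGerm T₀₀₁₁ (T₀₁₀₁ + T₀₁₁₀ + T₀₀₁₁) (T₀₀₀₀ − T₀₀₁₁ − T₀₁₀₁ − T₀₁₁₀) k μ ν` (`WardNormalisation.quadGerm cQ α γ` IS the general
  `B₄`-invariant quadratic germ: three invariants survive the `(a,b)`-symmetric contraction).
* §2 For a field–field kernel `M : MKer 4 (Fib 3)` whose column through `0` is exponentially localised (`|M x 0 (inl μ)(inl ν)| ≤ CM e^{−δM|x|₁}`, `δM > 0`):
  `quadMomentOf_eq_sum` — `quadMomentOf M k μ ν = Σ_{a,b} (−½ ∑'_x M x 0 (inl μ)(inl ν) x_a x_b) k_a k_b`; and if the column is COVARIANT under axis permutations of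
  the sites and fibre indices (`M (x ∘ σ⁻¹) 0 (inl σμ) (inl σν) = M x 0 (inl μ) (inl ν)`) and under reflections (`M (r_α x) 0 (inl μ) (inl ν) = rs α μ · rs α ν · M x 0 (inl μ)
  (inl ν)`, `(r_α x)_i = −x_i` for `i = α`, else `x_i`), the second-moment table is invariant (`secondMoment_perm`, `secondMoment_flip`, `tsum` re-indexed by the site
  equivalences), whence **`quadMomentOf_eq_quadGerm`**: `quadMomentOf M k μ ν = quadGerm cQ α γ k μ ν` with `cQ α γ` the three moment combinations above.
* §3 (v1.1, same seat — OWN LOCATED CORRECTION of the reflection letter) THE BOND LAW: a lattice reflection re-bases `α`-bonds (an2's `ResolventReflection.bref`), so a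
  translation-invariant 1-form Hessian obeys the SHIFTED column law `M (r_α x + t_{αμν} e_α) 0 (inl μ) (inl ν) = rs α μ · rs α ν · M x 0 (inl μ) (inl ν)` with an
  integer shift table `t` (`t = [ν=α] − [μ=α]` for `bref`), NOT §2's unshifted (0-form) letter off the diagonal `μ = ν`; `tsum_comp_flip_shift`, `cast_flip_shift`,
  `summable_lowMoments`, **`secondMoment_flip_shift`** (with vanishing ZEROTH and FIRST column moments the shift costs nothing) and **`quadMomentOf_eq_quadGerm_bond`**
  (the consumer-facing form of (h7) for lattice gauge-field Hessians).  §2's `quadMomentOf_eq_quadGerm` stays as landed: true as stated (the case `t = 0`).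
Provenance: G-an2-4 formalisation swarm seat b2b-balaban-gan24-formalise-leaf-02 gen 37 (cross-lane on road FP), 2026-08-20.
-/

noncomputable section

namespace Summit.QuantumFields.BalabanUV.Beta.FP.QuadGermUniqueness

open Finset
open scoped BigOperators
open Literature.MathematicalPhysics.QuantumFieldTheory.Balaban1983to89
open Literature.MathematicalPhysics.QuantumFieldTheory.Balaban1983to89.Beta
open Literature.MathematicalPhysics.QuantumFieldTheory.Balaban1983to89.B12Sec2to5 (l1 l1_nonneg abs_coord_le_l1)
open Literature.MathematicalPhysics.QuantumFieldTheory.Balaban1983to89.Beta.ExpKernelCalculus (Site MKer)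
open Literature.MathematicalPhysics.QuantumFieldTheory.Balaban1983to89.Beta.OneStepResolventKernel (Fib)
open Summit.QuantumFields.BalabanUV.Beta.FP.StencilMoments (summable_of_weight_exp)
open Summit.QuantumFields.BalabanUV.Beta.FP.MarginalUniqueness (Idx CubicGerm δ δ_comm δ_self δ_of_ne rs rs_self rs_of_ne PermInvariant FlipInvariant
  eq_zero_of_flip val_aabb val_abab val_abba val_aaaa)
open Summit.QuantumFields.BalabanUV.Beta.FP.WardNormalisation (quadGerm nsq)
open Summit.QuantumFields.BalabanUV.Beta.FP.CubicGermPairing (quadMomentOf)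

/-! ## §1 Invariant theory: a `B₄`-invariant rank-four table has four parameters; its `(a,b)`-symmetric contraction is `quadGerm cQ α γ` -/

section Algebra

variable {T : Idx → Idx → Idx → Idx → ℝ}

/-- [folklore] **CLASSIFICATION OF `B₄`-INVARIANT RANK-FOUR TABLES**: invariance under axis permutations and reflections leaves exactly the four invariants
`δ_{μν}δ_{ab}`, `δ_{μa}δ_{νb}`, `δ_{μb}δ_{νa}`, `[μ=ν=a=b]`, with coefficients read off the entries `T₀₀₁₁`, `T₀₁₀₁`, `T₀₁₁₀`, `T₀₀₀₀ − (T₀₀₁₁+T₀₁₀₁+T₀₁₁₀)`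
(`MarginalUniqueness`'s transports applied to the momentum-slot-constant cubic table `fun μ ν a b _ => T μ ν a b`). -/
theorem quadTable_unique (hP : ∀ (σ : Equiv.Perm Idx) (μ ν a b : Idx), T (σ μ) (σ ν) (σ a) (σ b) = T μ ν a b)
    (hF : ∀ (α μ ν a b : Idx), rs α μ * rs α ν * rs α a * rs α b * T μ ν a b = T μ ν a b) (μ ν a b : Idx) :
    T μ ν a b = T 0 0 1 1 * (δ μ ν * δ a b) + T 0 1 0 1 * (δ μ a * δ ν b) + T 0 1 1 0 * (δ μ b * δ ν a) +
      (T 0 0 0 0 - T 0 0 1 1 - T 0 1 0 1 - T 0 1 1 0) * (δ μ ν * δ μ a * δ μ b) := by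
  set L : CubicGerm := fun μ ν a b _ => T μ ν a b with hL
  have hP' : PermInvariant L := fun σ μ ν a b _ => hP σ μ ν a b
  have hF' : FlipInvariant L := fun α μ ν a b _ => hF α μ ν a b
  have eL : ∀ μ ν a b, T μ ν a b = L μ ν a b 0 := fun _ _ _ _ => rfl
  rw [eL μ ν a b, eL 0 0 1 1, eL 0 1 0 1, eL 0 1 1 0, eL 0 0 0 0]
  by_cases hmn : μ = ν
  · subst hmn
    by_cases hab : a = b
    · subst hab
      by_cases hma : μ = a
      · subst hma
        rw [val_aaaa hP' μ 0]
        simp only [δ_self, mul_one]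
        ring
      · rw [val_aabb hP' hma 0, δ_of_ne hma]
        simp only [δ_self, mul_one, mul_zero, add_zero]
    · by_cases hma : μ = a
      · subst hma
        rw [eq_zero_of_flip hF' b (μ := μ) (ν := μ) (lam := μ) (κ := b) 0 (by rw [rs_of_ne hab, rs_self]; norm_num), δ_of_ne hab]
        simp only [δ_self, mul_one, mul_zero, add_zero]
      · rw [eq_zero_of_flip hF' a (μ := μ) (ν := μ) (lam := a) (κ := b) 0
            (by rw [rs_of_ne hma, rs_self, rs_of_ne (Ne.symm hab)]; norm_num), δ_of_ne hab, δ_of_ne hma]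
        simp only [δ_self, mul_zero, zero_mul, add_zero]
  · rw [δ_of_ne hmn]
    by_cases hma : μ = a
    · subst hma
      by_cases hnb : ν = b
      · subst hnb
        rw [val_abab hP' hmn 0, δ_of_ne (Ne.symm hmn)]
        simp only [δ_self, mul_one, mul_zero, zero_mul, add_zero, zero_add]
      · rw [eq_zero_of_flip hF' ν (μ := μ) (ν := ν) (lam := μ) (κ := b) 0
            (by rw [rs_of_ne hmn, rs_self, rs_of_ne (Ne.symm hnb)]; norm_num), δ_of_ne hnb, δ_of_ne (Ne.symm hmn)]
        simp only [δ_self, mul_one, mul_zero, zero_mul, add_zero]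
    · rw [δ_of_ne hma]
      by_cases hmb : μ = b
      · subst hmb
        by_cases hna : ν = a
        · subst hna
          rw [val_abba hP' hmn 0]
          simp only [δ_self, mul_one, mul_zero, zero_mul, add_zero, zero_add]
        · rw [eq_zero_of_flip hF' ν (μ := μ) (ν := ν) (lam := a) (κ := μ) 0
              (by rw [rs_of_ne hmn, rs_self, rs_of_ne (Ne.symm hna)]; norm_num), δ_of_ne hna]
          simp only [δ_self, mul_one, mul_zero, zero_mul, add_zero]
      · rw [eq_zero_of_flip hF' μ (μ := μ) (ν := ν) (lam := a) (κ := b) 0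
            (by rw [rs_self, rs_of_ne (Ne.symm hmn), rs_of_ne (Ne.symm hma), rs_of_ne (Ne.symm hmb)]; norm_num), δ_of_ne hmb]
        simp only [mul_zero, zero_mul, add_zero]

/-- [folklore] **A `B₄`-INVARIANT QUADRATIC GERM IS `quadGerm cQ α γ`**: the `(a,b)`-contraction of an invariant table with `k_a k_b` is
`quadGerm T₀₀₁₁ (T₀₁₀₁ + T₀₁₁₀ + T₀₀₁₁) (T₀₀₀₀ − T₀₀₁₁ − T₀₁₀₁ − T₀₁₁₀) k μ ν` — so `WardNormalisation.quadGerm` IS the general hyperoctahedrally invariant quadratic germ. -/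
theorem quadForm_eq_quadGerm (hP : ∀ (σ : Equiv.Perm Idx) (μ ν a b : Idx), T (σ μ) (σ ν) (σ a) (σ b) = T μ ν a b)
    (hF : ∀ (α μ ν a b : Idx), rs α μ * rs α ν * rs α a * rs α b * T μ ν a b = T μ ν a b) (k : Idx → ℝ) (μ ν : Idx) :
    ∑ a, ∑ b, T μ ν a b * (k a * k b) =
      quadGerm (T 0 0 1 1) (T 0 1 0 1 + T 0 1 1 0 + T 0 0 1 1) (T 0 0 0 0 - T 0 0 1 1 - T 0 1 0 1 - T 0 1 1 0) k μ ν := by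
  have hT : ∀ a b, T μ ν a b = T 0 0 1 1 * (δ μ ν * δ a b) + T 0 1 0 1 * (δ μ a * δ ν b) + T 0 1 1 0 * (δ μ b * δ ν a) +
      (T 0 0 0 0 - T 0 0 1 1 - T 0 1 0 1 - T 0 1 1 0) * (δ μ ν * δ μ a * δ μ b) := fun a b => quadTable_unique hP hF μ ν a b
  simp only [hT]
  fin_cases μ <;> fin_cases ν <;> simp [Fin.sum_univ_four, δ, quadGerm, nsq] <;> ring

end Algebra

/-! ## §2 The second-moment table of a localised, lattice-covariant Hessian column; `quadMomentOf M = quadGerm cQ α γ` -/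

section Moments

variable {M : MKer 4 (Fib 3)} {CM δM : ℝ}

/-- [folklore] the second-moment weights `x_a x_b` of a localised column are summable. -/
theorem summable_secondMoment (hMcol : ∀ (x : Site 4) (μ ν : Fin 4), |M x 0 (Sum.inl μ) (Sum.inl ν)| ≤ CM * Real.exp (-δM * l1 x)) (hδM : 0 < δM)
    (μ ν a b : Fin 4) : Summable fun x : Site 4 => M x 0 (Sum.inl μ) (Sum.inl ν) * ((x a : ℝ) * (x b : ℝ)) := by
  have l10 : l1 (0 : Site 4) = 0 := by simp [l1]
  have hCM : 0 ≤ CM := by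
    have h := hMcol 0 μ ν
    rw [l10, mul_zero, Real.exp_zero, mul_one] at h
    exact (abs_nonneg _).trans h
  refine (summable_of_weight_exp (q := (0 : Site 4)) (k := 2) hδM hCM
    (g := fun x => M x 0 (Sum.inl μ) (Sum.inl ν) * ((x a : ℝ) * (x b : ℝ))) fun x => ?_).1
  rw [sub_zero, abs_mul, abs_mul]
  have ha := abs_coord_le_l1 x a
  have hb := abs_coord_le_l1 x b
  have hl := l1_nonneg x
  have hw : |(x a : ℝ)| * |(x b : ℝ)| ≤ (l1 x + 1) ^ 2 := by nlinarith [abs_nonneg ((x a : ℤ) : ℝ), abs_nonneg ((x b : ℤ) : ℝ)]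
  calc |M x 0 (Sum.inl μ) (Sum.inl ν)| * (|(x a : ℝ)| * |(x b : ℝ)|) ≤ (CM * Real.exp (-δM * l1 x)) * (l1 x + 1) ^ 2 :=
        mul_le_mul (hMcol x μ ν) hw (by positivity) (by positivity)
    _ = CM * (l1 x + 1) ^ 2 * Real.exp (-δM * l1 x) := by ring

/-- [folklore] **THE QUADRATIC GERM AS A CONTRACTION OF THE SECOND-MOMENT TABLE**:
`quadMomentOf M k μ ν = Σ_{a,b} (−½ ∑'_x M x 0 (inl μ)(inl ν) x_a x_b) · k_a k_b` (expand the square; finite sums leave the `∑'` by summability). -/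
theorem quadMomentOf_eq_sum (hMcol : ∀ (x : Site 4) (μ ν : Fin 4), |M x 0 (Sum.inl μ) (Sum.inl ν)| ≤ CM * Real.exp (-δM * l1 x)) (hδM : 0 < δM)
    (k : Fin 4 → ℝ) (μ ν : Fin 4) :
    quadMomentOf M k μ ν = ∑ a, ∑ b, (-(1 / 2 : ℝ) * ∑' x : Site 4, M x 0 (Sum.inl μ) (Sum.inl ν) * ((x a : ℝ) * (x b : ℝ))) * (k a * k b) := by
  have hab : ∀ a b, HasSum (fun x : Site 4 => M x 0 (Sum.inl μ) (Sum.inl ν) * ((k a * (x a : ℝ)) * (k b * (x b : ℝ))))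
      ((k a * k b) * ∑' x : Site 4, M x 0 (Sum.inl μ) (Sum.inl ν) * ((x a : ℝ) * (x b : ℝ))) := by
    intro a b
    refine ((summable_secondMoment hMcol hδM μ ν a b).hasSum.mul_left (k a * k b)).congr_fun fun x => ?_
    ring
  have hsum : HasSum (fun x : Site 4 => M x 0 (Sum.inl μ) (Sum.inl ν) * (∑ κ, k κ * (x κ : ℝ)) ^ 2)
      (∑ a, ∑ b, (k a * k b) * ∑' x : Site 4, M x 0 (Sum.inl μ) (Sum.inl ν) * ((x a : ℝ) * (x b : ℝ))) := by
    have h := hasSum_sum fun a (_ : a ∈ (Finset.univ : Finset (Fin 4))) => hasSum_sum fun b (_ : b ∈ (Finset.univ : Finset (Fin 4))) => hab a b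
    refine h.congr_fun fun x => ?_
    rw [sq, Finset.sum_mul_sum, Finset.mul_sum]
    refine Finset.sum_congr rfl fun a _ => ?_
    rw [Finset.mul_sum]
  unfold quadMomentOf
  rw [hsum.tsum_eq, Finset.mul_sum]
  refine Finset.sum_congr rfl fun a _ => ?_
  rw [Finset.mul_sum]
  refine Finset.sum_congr rfl fun b _ => ?_
  ring

/-- [folklore] RE-INDEXING the site sum by an axis permutation: `∑'_x f (x ∘ σ⁻¹) = ∑'_x f x`. -/
theorem tsum_comp_perm (σ : Equiv.Perm Idx) (f : Site 4 → ℝ) : ∑' x : Site 4, f (fun i => x (σ.symm i)) = ∑' x : Site 4, f x := by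
  let e : Site 4 ≃ Site 4 :=
    { toFun := fun x i => x (σ.symm i)
      invFun := fun x i => x (σ i)
      left_inv := fun x => funext fun i => by simp only [Equiv.symm_apply_apply]
      right_inv := fun x => funext fun i => by simp only [Equiv.apply_symm_apply] }
  exact e.tsum_eq f

/-- [folklore] RE-INDEXING the site sum by the reflection of axis `α` (an involution of `ℤ⁴`). -/
theorem tsum_comp_flip (α : Idx) (f : Site 4 → ℝ) : ∑' x : Site 4, f (fun i => if i = α then -x i else x i) = ∑' x : Site 4, f x := by
  have hinv : Function.Involutive fun x : Site 4 => (fun i => if i = α then -x i else x i) := by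
    intro x
    funext i
    by_cases h : i = α <;> simp [h]
  exact (hinv.toPerm _).tsum_eq f

/-- [folklore] the reflected coordinate as a real: `(r_α x)_a = rs α a · x_a`. -/
theorem cast_flip (α a : Idx) (x : Site 4) : (((if a = α then -x a else x a : ℤ)) : ℝ) = rs α a * (x a : ℝ) := by
  unfold rs
  by_cases h : a = α <;> simp [h]

/-- [folklore] **PERMUTATION INVARIANCE OF THE SECOND-MOMENT TABLE** from permutation covariance of the column. -/
theorem secondMoment_perm (hP : ∀ (σ : Equiv.Perm Idx) (x : Site 4) (μ ν : Fin 4),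
      M (fun i => x (σ.symm i)) 0 (Sum.inl (σ μ)) (Sum.inl (σ ν)) = M x 0 (Sum.inl μ) (Sum.inl ν))
    (σ : Equiv.Perm Idx) (μ ν a b : Idx) :
    (-(1 / 2 : ℝ) * ∑' x : Site 4, M x 0 (Sum.inl (σ μ)) (Sum.inl (σ ν)) * ((x (σ a) : ℝ) * (x (σ b) : ℝ))) =
      -(1 / 2 : ℝ) * ∑' x : Site 4, M x 0 (Sum.inl μ) (Sum.inl ν) * ((x a : ℝ) * (x b : ℝ)) := by
  congr 1
  have key : (∑' x : Site 4, M (fun i => x (σ.symm i)) 0 (Sum.inl (σ μ)) (Sum.inl (σ ν)) * ((x (σ.symm (σ a)) : ℝ) * (x (σ.symm (σ b)) : ℝ))) =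
      ∑' x : Site 4, M x 0 (Sum.inl (σ μ)) (Sum.inl (σ ν)) * ((x (σ a) : ℝ) * (x (σ b) : ℝ)) :=
    tsum_comp_perm σ (fun x : Site 4 => M x 0 (Sum.inl (σ μ)) (Sum.inl (σ ν)) * ((x (σ a) : ℝ) * (x (σ b) : ℝ)))
  rw [← key]
  refine tsum_congr fun x => ?_
  rw [hP, Equiv.symm_apply_apply, Equiv.symm_apply_apply]

/-- [folklore] **REFLECTION INVARIANCE OF THE SECOND-MOMENT TABLE** from reflection covariance of the column. -/
theorem secondMoment_flip (hF : ∀ (α : Idx) (x : Site 4) (μ ν : Fin 4),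
      M (fun i => if i = α then -x i else x i) 0 (Sum.inl μ) (Sum.inl ν) = rs α μ * rs α ν * M x 0 (Sum.inl μ) (Sum.inl ν))
    (α μ ν a b : Idx) :
    rs α μ * rs α ν * rs α a * rs α b * (-(1 / 2 : ℝ) * ∑' x : Site 4, M x 0 (Sum.inl μ) (Sum.inl ν) * ((x a : ℝ) * (x b : ℝ))) =
      -(1 / 2 : ℝ) * ∑' x : Site 4, M x 0 (Sum.inl μ) (Sum.inl ν) * ((x a : ℝ) * (x b : ℝ)) := by
  have key : (∑' x : Site 4, M x 0 (Sum.inl μ) (Sum.inl ν) * ((x a : ℝ) * (x b : ℝ))) =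
      (rs α μ * rs α ν * rs α a * rs α b) * ∑' x : Site 4, M x 0 (Sum.inl μ) (Sum.inl ν) * ((x a : ℝ) * (x b : ℝ)) := by
    calc (∑' x : Site 4, M x 0 (Sum.inl μ) (Sum.inl ν) * ((x a : ℝ) * (x b : ℝ)))
        = ∑' x : Site 4, M (fun i => if i = α then -x i else x i) 0 (Sum.inl μ) (Sum.inl ν) *
            ((((if a = α then -x a else x a : ℤ)) : ℝ) * (((if b = α then -x b else x b : ℤ)) : ℝ)) :=
          (tsum_comp_flip α (fun x : Site 4 => M x 0 (Sum.inl μ) (Sum.inl ν) * ((x a : ℝ) * (x b : ℝ)))).symm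
      _ = ∑' x : Site 4, (rs α μ * rs α ν * rs α a * rs α b) * (M x 0 (Sum.inl μ) (Sum.inl ν) * ((x a : ℝ) * (x b : ℝ))) :=
          tsum_congr fun x => by rw [hF, cast_flip, cast_flip]; ring
      _ = (rs α μ * rs α ν * rs α a * rs α b) * ∑' x : Site 4, M x 0 (Sum.inl μ) (Sum.inl ν) * ((x a : ℝ) * (x b : ℝ)) := tsum_mul_left
  linear_combination (1 / 2 : ℝ) * key

/-- [our object] **THE SECOND-MOMENT GERM OF A LOCALISED, LATTICE-COVARIANT HESSIAN COLUMN IS `quadGerm cQ α γ`** with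
`cQ = T₀₀₁₁`, `α = T₀₁₀₁ + T₀₁₁₀ + T₀₀₁₁`, `γ = T₀₀₀₀ − T₀₀₁₁ − T₀₁₀₁ − T₀₁₁₀`, `T μ ν a b = −½ ∑'_x M x 0 (inl μ)(inl ν) x_a x_b` — the hypothesis `hQ` of
`CubicGermWard.cubicGermOf_eq_of_law_anti13` from lattice symmetry of the Hessian block alone (Ward then forces `α = γ = 0`). -/
theorem quadMomentOf_eq_quadGerm (hMcol : ∀ (x : Site 4) (μ ν : Fin 4), |M x 0 (Sum.inl μ) (Sum.inl ν)| ≤ CM * Real.exp (-δM * l1 x)) (hδM : 0 < δM)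
    (hP : ∀ (σ : Equiv.Perm Idx) (x : Site 4) (μ ν : Fin 4),
      M (fun i => x (σ.symm i)) 0 (Sum.inl (σ μ)) (Sum.inl (σ ν)) = M x 0 (Sum.inl μ) (Sum.inl ν))
    (hF : ∀ (α : Idx) (x : Site 4) (μ ν : Fin 4),
      M (fun i => if i = α then -x i else x i) 0 (Sum.inl μ) (Sum.inl ν) = rs α μ * rs α ν * M x 0 (Sum.inl μ) (Sum.inl ν))
    (k : Fin 4 → ℝ) (μ ν : Fin 4) :
    quadMomentOf M k μ ν =
      quadGerm (-(1 / 2 : ℝ) * ∑' x : Site 4, M x 0 (Sum.inl 0) (Sum.inl 0) * ((x 1 : ℝ) * (x 1 : ℝ)))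
        ((-(1 / 2 : ℝ) * ∑' x : Site 4, M x 0 (Sum.inl 0) (Sum.inl 1) * ((x 0 : ℝ) * (x 1 : ℝ))) +
          (-(1 / 2 : ℝ) * ∑' x : Site 4, M x 0 (Sum.inl 0) (Sum.inl 1) * ((x 1 : ℝ) * (x 0 : ℝ))) +
          (-(1 / 2 : ℝ) * ∑' x : Site 4, M x 0 (Sum.inl 0) (Sum.inl 0) * ((x 1 : ℝ) * (x 1 : ℝ))))
        ((-(1 / 2 : ℝ) * ∑' x : Site 4, M x 0 (Sum.inl 0) (Sum.inl 0) * ((x 0 : ℝ) * (x 0 : ℝ))) -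
          (-(1 / 2 : ℝ) * ∑' x : Site 4, M x 0 (Sum.inl 0) (Sum.inl 0) * ((x 1 : ℝ) * (x 1 : ℝ))) -
          (-(1 / 2 : ℝ) * ∑' x : Site 4, M x 0 (Sum.inl 0) (Sum.inl 1) * ((x 0 : ℝ) * (x 1 : ℝ))) -
          (-(1 / 2 : ℝ) * ∑' x : Site 4, M x 0 (Sum.inl 0) (Sum.inl 1) * ((x 1 : ℝ) * (x 0 : ℝ))))
        k μ ν := by
  rw [quadMomentOf_eq_sum hMcol hδM]
  exact quadForm_eq_quadGerm (T := fun μ ν a b => -(1 / 2 : ℝ) * ∑' x : Site 4, M x 0 (Sum.inl μ) (Sum.inl ν) * ((x a : ℝ) * (x b : ℝ)))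
    (fun σ μ ν a b => secondMoment_perm hP σ μ ν a b) (fun α μ ν a b => secondMoment_flip hF α μ ν a b) k μ ν

end Moments

/-! ## §3 (v1.1) The BOND reflection law: reflections re-base `α`-bonds, so the column covariance carries an integer SHIFT along `α`;
with vanishing zeroth and first column moments the second-moment table is still invariant -/

section Bond

variable {M : MKer 4 (Fib 3)} {CM δM : ℝ}

/-- [folklore] (v1.1) RE-INDEXING the site sum by the SHIFTED reflection of axis `α`, `x ↦ (x_i)_{i≠α}, −x_α + s` (an involution of `ℤ⁴` for every `s`). -/
theorem tsum_comp_flip_shift (α : Idx) (s : ℤ) (f : Site 4 → ℝ) :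
    ∑' x : Site 4, f (fun i => if i = α then -x i + s else x i) = ∑' x : Site 4, f x := by
  have hinv : Function.Involutive fun x : Site 4 => (fun i => if i = α then -x i + s else x i) := by
    intro x
    funext i
    by_cases h : i = α <;> simp [h]
  exact (hinv.toPerm _).tsum_eq f

/-- [folklore] (v1.1) the shifted reflected coordinate as a real: `rs α a · x_a + [a = α]·s`. -/
theorem cast_flip_shift (α a : Idx) (s : ℤ) (x : Site 4) :
    (((if a = α then -x a + s else x a : ℤ)) : ℝ) = rs α a * (x a : ℝ) + (if a = α then (s : ℝ) else 0) := by
  unfold rs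
  by_cases h : a = α <;> simp [h]

/-- [folklore] (v1.1) summability of the zeroth and first column moments of a localised column. -/
theorem summable_lowMoments (hMcol : ∀ (x : Site 4) (μ ν : Fin 4), |M x 0 (Sum.inl μ) (Sum.inl ν)| ≤ CM * Real.exp (-δM * l1 x)) (hδM : 0 < δM)
    (μ ν a : Fin 4) :
    Summable (fun x : Site 4 => M x 0 (Sum.inl μ) (Sum.inl ν)) ∧ Summable (fun x : Site 4 => M x 0 (Sum.inl μ) (Sum.inl ν) * (x a : ℝ)) := by
  have l10 : l1 (0 : Site 4) = 0 := by simp [l1]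
  have hCM : 0 ≤ CM := by
    have h := hMcol 0 μ ν
    rw [l10, mul_zero, Real.exp_zero, mul_one] at h
    exact (abs_nonneg _).trans h
  refine ⟨(summable_of_weight_exp (q := (0 : Site 4)) (k := 0) hδM hCM (g := fun x => M x 0 (Sum.inl μ) (Sum.inl ν)) fun x => ?_).1,
    (summable_of_weight_exp (q := (0 : Site 4)) (k := 1) hδM hCM (g := fun x => M x 0 (Sum.inl μ) (Sum.inl ν) * (x a : ℝ)) fun x => ?_).1⟩
  · rw [sub_zero, pow_zero, mul_one]
    exact hMcol x μ ν
  · rw [sub_zero, abs_mul, pow_one]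
    have ha := abs_coord_le_l1 x a
    have hl := l1_nonneg x
    calc |M x 0 (Sum.inl μ) (Sum.inl ν)| * |(x a : ℝ)| ≤ (CM * Real.exp (-δM * l1 x)) * (l1 x + 1) :=
          mul_le_mul (hMcol x μ ν) (ha.trans (by linarith)) (abs_nonneg _) (by positivity)
      _ = CM * (l1 x + 1) * Real.exp (-δM * l1 x) := by ring

/-- [folklore] (v1.1) **REFLECTION INVARIANCE OF THE SECOND-MOMENT TABLE UNDER THE BOND (SHIFTED) LAW.**  A lattice reflection of axis `α` maps the bond
`(x, μ)` to a bond based at the reflected site SHIFTED along `α` when `μ = α` (an2's `ResolventReflection.bref`); for a translation-invariant Hessian the column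
through `0` therefore obeys `M (r_α x + t_{αμν}·e_α) 0 (inl μ) (inl ν) = rs α μ · rs α ν · M x 0 (inl μ) (inl ν)` with an INTEGER SHIFT `t` (for `bref`:
`t = [ν = α] − [μ = α]`).  If the zeroth and first column moments vanish (the shift then costs nothing), the second-moment table is reflection invariant. -/
theorem secondMoment_flip_shift (hMcol : ∀ (x : Site 4) (μ ν : Fin 4), |M x 0 (Sum.inl μ) (Sum.inl ν)| ≤ CM * Real.exp (-δM * l1 x)) (hδM : 0 < δM)
    (hM0 : ∀ (μ ν : Fin 4), ∑' x : Site 4, M x 0 (Sum.inl μ) (Sum.inl ν) = 0)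
    (hM1 : ∀ (μ ν κ : Fin 4), ∑' x : Site 4, M x 0 (Sum.inl μ) (Sum.inl ν) * (x κ : ℝ) = 0)
    (t : Idx → Idx → Idx → ℤ)
    (hF : ∀ (α : Idx) (x : Site 4) (μ ν : Fin 4),
      M (fun i => if i = α then -x i + t α μ ν else x i) 0 (Sum.inl μ) (Sum.inl ν) = rs α μ * rs α ν * M x 0 (Sum.inl μ) (Sum.inl ν))
    (α μ ν a b : Idx) :
    rs α μ * rs α ν * rs α a * rs α b * (-(1 / 2 : ℝ) * ∑' x : Site 4, M x 0 (Sum.inl μ) (Sum.inl ν) * ((x a : ℝ) * (x b : ℝ))) =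
      -(1 / 2 : ℝ) * ∑' x : Site 4, M x 0 (Sum.inl μ) (Sum.inl ν) * ((x a : ℝ) * (x b : ℝ)) := by
  have h2 := (summable_secondMoment hMcol hδM μ ν a b).hasSum
  have h1a := (summable_lowMoments hMcol hδM μ ν a).2.hasSum
  have h1b := (summable_lowMoments hMcol hδM μ ν b).2.hasSum
  have h0 := (summable_lowMoments hMcol hδM μ ν a).1.hasSum
  rw [hM1] at h1a h1b
  rw [hM0] at h0
  -- the reflected sum, expanded into second, first and zeroth moments
  have hc := (((h2.mul_left (rs α a * rs α b)).add ((h1a.mul_left (rs α a * (if b = α then (t α μ ν : ℝ) else 0))).add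
    ((h1b.mul_left ((if a = α then (t α μ ν : ℝ) else 0) * rs α b)).add
    (h0.mul_left ((if a = α then (t α μ ν : ℝ) else 0) * (if b = α then (t α μ ν : ℝ) else 0)))))).mul_left (rs α μ * rs α ν))
  have hexp : HasSum (fun x : Site 4 => M (fun i => if i = α then -x i + t α μ ν else x i) 0 (Sum.inl μ) (Sum.inl ν) *
      ((((if a = α then -x a + t α μ ν else x a : ℤ)) : ℝ) * (((if b = α then -x b + t α μ ν else x b : ℤ)) : ℝ)))
      (rs α μ * rs α ν * (rs α a * rs α b * (∑' x : Site 4, M x 0 (Sum.inl μ) (Sum.inl ν) * ((x a : ℝ) * (x b : ℝ))) +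
        (rs α a * (if b = α then (t α μ ν : ℝ) else 0) * 0 + ((if a = α then (t α μ ν : ℝ) else 0) * rs α b * 0 +
          (if a = α then (t α μ ν : ℝ) else 0) * (if b = α then (t α μ ν : ℝ) else 0) * 0)))) := by
    refine hc.congr_fun fun x => ?_
    rw [hF α x μ ν, cast_flip_shift, cast_flip_shift]
    ring
  have e := hexp.tsum_eq
  rw [tsum_comp_flip_shift α (t α μ ν) (fun x : Site 4 => M x 0 (Sum.inl μ) (Sum.inl ν) * ((x a : ℝ) * (x b : ℝ)))] at e
  linear_combination (1 / 2 : ℝ) * e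

/-- [our object] (v1.1) **THE SECOND-MOMENT GERM UNDER THE BOND LAWS IS `quadGerm cQ α γ`**: for a localised Hessian column with vanishing ZEROTH and FIRST
moments, covariant under axis permutations (`M (x ∘ σ⁻¹) 0 (inl σμ) (inl σν) = M x 0 (inl μ) (inl ν)`) and under the SHIFTED reflections of the bond law
(`M (r_α x + t_{αμν} e_α) 0 (inl μ) (inl ν) = rs α μ · rs α ν · M x 0 (inl μ) (inl ν)`, any integer shift table `t`): `quadMomentOf M k μ ν = quadGerm cQ α γ k μ ν`
with the three moment combinations of `quadMomentOf_eq_quadGerm`.  (The v1 statement `quadMomentOf_eq_quadGerm` is the case `t = 0` WITHOUT the moment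
hypotheses — true as stated, but its unshifted reflection letter is the law of a SITE (0-form) kernel; lattice 1-form Hessians such as the `d*d` window obey the
shifted law, `t = [ν=α] − [μ=α]` for an2's `bref`.) -/
theorem quadMomentOf_eq_quadGerm_bond (hMcol : ∀ (x : Site 4) (μ ν : Fin 4), |M x 0 (Sum.inl μ) (Sum.inl ν)| ≤ CM * Real.exp (-δM * l1 x)) (hδM : 0 < δM)
    (hM0 : ∀ (μ ν : Fin 4), ∑' x : Site 4, M x 0 (Sum.inl μ) (Sum.inl ν) = 0)
    (hM1 : ∀ (μ ν κ : Fin 4), ∑' x : Site 4, M x 0 (Sum.inl μ) (Sum.inl ν) * (x κ : ℝ) = 0)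
    (hP : ∀ (σ : Equiv.Perm Idx) (x : Site 4) (μ ν : Fin 4),
      M (fun i => x (σ.symm i)) 0 (Sum.inl (σ μ)) (Sum.inl (σ ν)) = M x 0 (Sum.inl μ) (Sum.inl ν))
    (t : Idx → Idx → Idx → ℤ)
    (hF : ∀ (α : Idx) (x : Site 4) (μ ν : Fin 4),
      M (fun i => if i = α then -x i + t α μ ν else x i) 0 (Sum.inl μ) (Sum.inl ν) = rs α μ * rs α ν * M x 0 (Sum.inl μ) (Sum.inl ν))
    (k : Fin 4 → ℝ) (μ ν : Fin 4) :
    quadMomentOf M k μ ν =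
      quadGerm (-(1 / 2 : ℝ) * ∑' x : Site 4, M x 0 (Sum.inl 0) (Sum.inl 0) * ((x 1 : ℝ) * (x 1 : ℝ)))
        ((-(1 / 2 : ℝ) * ∑' x : Site 4, M x 0 (Sum.inl 0) (Sum.inl 1) * ((x 0 : ℝ) * (x 1 : ℝ))) +
          (-(1 / 2 : ℝ) * ∑' x : Site 4, M x 0 (Sum.inl 0) (Sum.inl 1) * ((x 1 : ℝ) * (x 0 : ℝ))) +
          (-(1 / 2 : ℝ) * ∑' x : Site 4, M x 0 (Sum.inl 0) (Sum.inl 0) * ((x 1 : ℝ) * (x 1 : ℝ))))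
        ((-(1 / 2 : ℝ) * ∑' x : Site 4, M x 0 (Sum.inl 0) (Sum.inl 0) * ((x 0 : ℝ) * (x 0 : ℝ))) -
          (-(1 / 2 : ℝ) * ∑' x : Site 4, M x 0 (Sum.inl 0) (Sum.inl 0) * ((x 1 : ℝ) * (x 1 : ℝ))) -
          (-(1 / 2 : ℝ) * ∑' x : Site 4, M x 0 (Sum.inl 0) (Sum.inl 1) * ((x 0 : ℝ) * (x 1 : ℝ))) -
          (-(1 / 2 : ℝ) * ∑' x : Site 4, M x 0 (Sum.inl 0) (Sum.inl 1) * ((x 1 : ℝ) * (x 0 : ℝ))))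
        k μ ν := by
  rw [quadMomentOf_eq_sum hMcol hδM]
  exact quadForm_eq_quadGerm (T := fun μ ν a b => -(1 / 2 : ℝ) * ∑' x : Site 4, M x 0 (Sum.inl μ) (Sum.inl ν) * ((x a : ℝ) * (x b : ℝ)))
    (fun σ μ ν a b => secondMoment_perm hP σ μ ν a b) (fun α μ ν a b => secondMoment_flip_shift hMcol hδM hM0 hM1 t hF α μ ν a b) k μ ν

end Bond

end Summit.QuantumFields.BalabanUV.Beta.FP.QuadGermUniqueness
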